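import Summits.AtomisticToContinuum.HydrodynamicLimit.Theorems.CollisionIsometryCLTMacroClosureStubThermoLambda
import Summits.AtomisticToContinuum.HydrodynamicLimit.Theorems.CollisionIsometryCLTMacroClosureStubThermoFlux

/-!
# Stub `stub_thermo` of the line `IdeatorTwoGen1Sketch` (crux `MacroClosure`, stmt-14870) —
# part 3c: the entropy / entropy-flux compatibility of the hard-sphere Euler system (clause 3)

Support file (registered sub-goal `stub_thermo_compat`) for the stub
`Barycentric.stub_thermo : ∃ η₃, 0 < η₃ ∧ ThermoChamber η₃`.

For a classical hs-Euler solution in the dilute chamber and its entropy-variable field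
`Λ = Dη_σ(U_cl)`:
* `compat_identity` — `∂ₛΛ·V + Σⱼ ∂ⱼΛ·(DFⱼ(U_cl)V) = 0` for every `V`: the time derivatives of
  `(ρ, u, θ)` are eliminated with the primitive equations
  (`IsHardSphereEulerSolution.timeDeriv_density_eq`, `density_mul_timeDeriv_velocity_eq`,
  `timeDeriv_temperature_eq` with the law `ζ(r) = Z(rσ³)`), the derivatives of `Λ` come from
  part 3a and the flux Jacobians from part 3b; what is left is a rational-function identity in the
  point values (the symmetry of `D²η_σ DFⱼ`, i.e. the Gibbs relation of the athermal hard-sphere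
  gas `p = ρθZ`, `e = (3/2)θ`, `s = (3/2)log θ − log ρ − f_ex`), closed by `field_simp; ring`;
* `partialDeriv_Lambda_flux` — `∂ⱼΛ·Fⱼ(U_cl) = ∂ⱼ(ρ Z u_j)` pointwise (entropy flux `q = ηu`),
  whence `∫ Σⱼ ∂ⱼΛ·Fⱼ(U_cl) = 0` (`integral_partialDeriv_eq_zero_of_isContDiff`);
* `stub_thermo_compat` — clause 3 of `ThermoChamber η` for every `η ≤ η₀`.
-/

noncomputable section

open MeasureTheory Filter Set Topology InformationTheory
open scoped ENNReal ContDiff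

namespace Summit.AtomisticToContinuum.HydrodynamicLimit.Theorems.MacroClosureLine

open Literature.MathematicalPhysics.KineticTheory Literature.Analysis.FluidPDE
open Literature.Analysis.FunctionSpaces

namespace Barycentric

variable {η₀ : ℝ} {F : ℝ → ℝ}
variable {σ η T : ℝ} {ρ θ : ℝ → T3 → ℝ} {u : ℝ → T3 → V3}

/-- The rescaled compressibility law `ζ(r) = Z(rσ³)` is smooth on the open set of densities
with packing in `(0, η₀)`, which contains the densities of the solution. -/
theorem zeta_data (hFa : AnalyticOnNhd ℝ F (Ioo (-η₀) η₀))
    (hF : EqOn hsExcessFreeEnergy F (Ico 0 η₀)) (hσ : 0 < σ)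
    (hE : IsHardSphereEulerSolution σ T ρ u θ) (hη : η ≤ η₀)
    (hpack : ∀ s ∈ Ico 0 T, ∀ x, ρ s x * σ ^ 3 < η) :
    IsOpen {r : ℝ | r * σ ^ 3 ∈ Ioo 0 η₀} ∧
    ContDiffOn ℝ ∞ (fun r => hsCompressibility (r * σ ^ 3)) {r : ℝ | r * σ ^ 3 ∈ Ioo 0 η₀} ∧
    (∀ t ∈ Ico 0 T, ∀ y, ρ t y ∈ {r : ℝ | r * σ ^ 3 ∈ Ioo 0 η₀}) ∧
    ∀ t ∈ Ico 0 T, ∀ y, hsPressure σ (ρ t y) (θ t y) =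
      ρ t y * θ t y * (fun r => hsCompressibility (r * σ ^ 3)) (ρ t y) :=
  ⟨isOpen_Ioo.preimage (continuous_id.mul continuous_const),
    (analyticOnNhd_hsCompressibility hFa hF).contDiffOn_of_completeSpace.comp
      (contDiff_id.mul contDiff_const).contDiffOn fun r hr => hr,
    fun t ht y => ⟨mul_pos (hE.density_pos t ht y) (by positivity), (hpack t ht y).trans_le hη⟩,
    fun _ _ _ => rfl⟩

set_option maxHeartbeats 1600000 in
/-- **Clause 3c: the compatibility identity** `∂ₛΛ·V + Σⱼ ∂ⱼΛ·(DFⱼ(U_cl)V) = 0` (the final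
rational-function identity is large: heartbeats raised). -/
theorem compat_identity (hFa : AnalyticOnNhd ℝ F (Ioo (-η₀) η₀))
    (hF : EqOn hsExcessFreeEnergy F (Ico 0 η₀)) (hσ : 0 < σ)
    (hE : IsHardSphereEulerSolution σ T ρ u θ) (hη : η ≤ η₀)
    (hpack : ∀ s ∈ Ico 0 T, ∀ x, ρ s x * σ ^ 3 < η) {s : ℝ} (hs : s ∈ Ico 0 T) (x : T3)
    (V : State) :
    Torus.timeDerivWithin (Ico 0 T)
        (fun s x => fderiv ℝ (hsEntropy σ) (stateOf (ρ s x) (u s x) (θ s x))) s x V +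
      ∑ j, Torus.partialDeriv j (fun y => fderiv ℝ (hsEntropy σ) (stateOf (ρ s y) (u s y) (θ s y))) x
        (fderiv ℝ (eulerFlux σ j) (stateOf (ρ s x) (u s x) (θ s x)) V) = 0 := by
  obtain ⟨hJ, hζ, hρJ, hp⟩ := zeta_data hFa hF hσ hE hη hpack
  have hU : UniqueDiffOn ℝ (Ico (0 : ℝ) T) := uniqueDiffOn_Ico 0 T
  have hρpos := hE.density_pos s hs x
  have hθpos := hE.temperature_pos s hs x
  have hρ0 : ρ s x ≠ 0 := hρpos.ne'
  have hθ0 : θ s x ≠ 0 := hθpos.ne'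
  have hxI : ρ s x * σ ^ 3 ∈ Ioo 0 η₀ := hρJ s hs x
  have hu1 : Torus.IsContDiff 1 (u s) := (hE.smooth_velocity.isSmooth_slice hs).isContDiff (by simp)
  -- the primitive equations
  have hP1 := hE.timeDeriv_density_eq hs x
  have hP2 := fun k => hE.density_mul_timeDeriv_velocity_eq hJ hζ hρJ hp hs x k
  have hP3 := IsHardSphereEulerSolution.timeDeriv_temperature_eq hE hJ hζ hρJ hp hs x
  have hζ' : deriv (fun r => hsCompressibility (r * σ ^ 3)) (ρ s x) =
      σ ^ 3 * deriv hsCompressibility (ρ s x * σ ^ 3) := deriv_hsCompressibility_rescale hFa hF hxI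
  rw [hζ'] at hP2
  have hP2' : ∀ k, Torus.timeDerivWithin (Ico 0 T) (fun s y => u s y k) s x =
      (-(ρ s x * ∑ i, u s x i * Torus.partialDeriv i (fun y => u s y k) x) -
        (θ s x * (hsCompressibility (ρ s x * σ ^ 3) +
            ρ s x * (σ ^ 3 * deriv hsCompressibility (ρ s x * σ ^ 3))) *
            Torus.partialDeriv k (ρ s) x +
          ρ s x * hsCompressibility (ρ s x * σ ^ 3) * Torus.partialDeriv k (θ s) x)) / ρ s x := by
    intro k
    rw [eq_div_iff hρ0, mul_comm]
    exact hP2 k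
  -- expand the derivatives of `Λ` and the flux Jacobians
  rw [timeDerivWithin_Lambda_apply hFa hF hσ hE hη hpack hs x V]
  simp only [Fin.sum_univ_three]
  rw [fderiv_eulerFlux_apply hFa hF (u s x) hσ hρpos hθpos hxI.2 0 V,
    fderiv_eulerFlux_apply hFa hF (u s x) hσ hρpos hθpos hxI.2 1 V,
    fderiv_eulerFlux_apply hFa hF (u s x) hσ hρpos hθpos hxI.2 2 V,
    partialDeriv_Lambda_apply hFa hF hσ hE hη hpack hs x 0,
    partialDeriv_Lambda_apply hFa hF hσ hE hη hpack hs x 1,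
    partialDeriv_Lambda_apply hFa hF hσ hE hη hpack hs x 2]
  -- pass to coordinates
  simp only [inner_add_right, inner_smul_right, inner_single_one_right]
  simp only [inner_fin3, EuclideanSpace.real_norm_sq_eq, Fin.sum_univ_three]
  simp only [← HsEulerCalc.timeDerivWithin_apply_coord hE.smooth_velocity hU hs x,
    ← Torus.partialDeriv_apply_coord hu1]
  rw [hP1, hP3, hP2' 0, hP2' 1, hP2' 2]
  simp only [Fin.sum_univ_three]
  rw [hsCompressibility_eq hF hxI, deriv_hsCompressibility_eq hFa hF hxI]
  field_simp
  ring

set_option maxHeartbeats 800000 in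
/-- **The entropy flux, pointwise**: `∂ⱼΛ·Fⱼ(U_cl) = ∂ⱼ(ρ Z(ρσ³) u_j)`. -/
theorem partialDeriv_Lambda_flux (hFa : AnalyticOnNhd ℝ F (Ioo (-η₀) η₀))
    (hF : EqOn hsExcessFreeEnergy F (Ico 0 η₀)) (hσ : 0 < σ)
    (hE : IsHardSphereEulerSolution σ T ρ u θ) (hη : η ≤ η₀)
    (hpack : ∀ s ∈ Ico 0 T, ∀ x, ρ s x * σ ^ 3 < η) {s : ℝ} (hs : s ∈ Ico 0 T) (x : T3)
    (j : Fin 3) :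
    Torus.partialDeriv j (fun y => fderiv ℝ (hsEntropy σ) (stateOf (ρ s y) (u s y) (θ s y))) x
        (eulerFlux σ j (stateOf (ρ s x) (u s x) (θ s x))) =
      Torus.partialDeriv j (fun y => ρ s y * u s y j * hsCompressibility (ρ s y * σ ^ 3)) x := by
  obtain ⟨hJ, hζ, hρJ, -⟩ := zeta_data hFa hF hσ hE hη hpack
  have hρpos := hE.density_pos s hs x
  have hθpos := hE.temperature_pos s hs x
  have hρ0 : ρ s x ≠ 0 := hρpos.ne'
  have hθ0 : θ s x ≠ 0 := hθpos.ne'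
  have hxI : ρ s x * σ ^ 3 ∈ Ioo 0 η₀ := hρJ s hs x
  have hρ1 : Torus.IsContDiff 1 (ρ s) := (hE.smooth_density.isSmooth_slice hs).isContDiff (by simp)
  have hu1 : Torus.IsContDiff 1 (u s) := (hE.smooth_velocity.isSmooth_slice hs).isContDiff (by simp)
  have huj1 : Torus.IsContDiff 1 (fun y => u s y j) := HsEulerCalc.isContDiff_apply_coord hu1 j
  -- the right-hand side by the product rule along the coordinate line
  have cρ := HsEulerCalc.hasDerivAt_coordLine hρ1 x j
  have cu := HsEulerCalc.hasDerivAt_coordLine huj1 x j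
  have cζ := HsEulerCalc.hasDerivAt_coordLine_comp hρ1 hJ hζ x (hρJ s hs x) j
  rw [deriv_hsCompressibility_rescale hFa hF hxI] at cζ
  have hR : Torus.partialDeriv j (fun y => ρ s y * u s y j * hsCompressibility (ρ s y * σ ^ 3)) x =
      (Torus.partialDeriv j (ρ s) x * u s x j + ρ s x * Torus.partialDeriv j (fun y => u s y j) x) *
          hsCompressibility (ρ s x * σ ^ 3) +
        ρ s x * u s x j *
          (σ ^ 3 * deriv hsCompressibility (ρ s x * σ ^ 3) * Torus.partialDeriv j (ρ s) x) :=
    HsEulerCalc.partialDeriv_eq_of_hasDerivAt (((cρ.fun_mul cu).fun_mul cζ).congr_deriv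
      (by simp only [zero_smul, Torus.proj_zero, add_zero]))
  rw [hR]
  -- the left-hand side by the formula for `∂ⱼΛ` and the explicit flux
  rw [eulerFlux_stateOf σ hρ0 (u s x) (θ s x) j, partialDeriv_Lambda_apply hFa hF hσ hE hη hpack hs x j]
  simp only [inner_add_right, inner_smul_right, inner_single_one_right]
  simp only [inner_fin3, EuclideanSpace.real_norm_sq_eq, Fin.sum_univ_three,
    ← Torus.partialDeriv_apply_coord hu1]
  rw [hsCompressibility_eq hF hxI, deriv_hsCompressibility_eq hFa hF hxI]
  field_simp
  ring

/-- **Clause 3d: the total entropy flux integrates to zero**,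
`∫ₓ Σⱼ ∂ⱼΛ·Fⱼ(U_cl) = Σⱼ ∫ₓ ∂ⱼ(ρ Z u_j) = 0`. -/
theorem integral_Lambda_flux (hFa : AnalyticOnNhd ℝ F (Ioo (-η₀) η₀))
    (hF : EqOn hsExcessFreeEnergy F (Ico 0 η₀)) (hσ : 0 < σ)
    (hE : IsHardSphereEulerSolution σ T ρ u θ) (hη : η ≤ η₀)
    (hpack : ∀ s ∈ Ico 0 T, ∀ x, ρ s x * σ ^ 3 < η) {s : ℝ} (hs : s ∈ Ico 0 T) :
    ∫ x, ∑ j, Torus.partialDeriv j (fun y => fderiv ℝ (hsEntropy σ) (stateOf (ρ s y) (u s y) (θ s y)))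
      x (eulerFlux σ j (stateOf (ρ s x) (u s x) (θ s x))) = 0 := by
  obtain ⟨hJ, hζ, hρJ, -⟩ := zeta_data hFa hF hσ hE hη hpack
  have hρs : Torus.IsSmooth (ρ s) := hE.smooth_density.isSmooth_slice hs
  have hus : Torus.IsSmooth (u s) := hE.smooth_velocity.isSmooth_slice hs
  have hZs : Torus.IsSmooth (fun y => hsCompressibility (ρ s y * σ ^ 3)) :=
    hζ.comp_contDiff hρs fun v => hρJ s hs _
  have hg : ∀ j : Fin 3, Torus.IsSmooth (fun y => ρ s y * u s y j * hsCompressibility (ρ s y * σ ^ 3)) :=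
    fun j => (hρs.mul (hus.apply j)).mul hZs
  have hfun : (fun x => ∑ j, Torus.partialDeriv j
      (fun y => fderiv ℝ (hsEntropy σ) (stateOf (ρ s y) (u s y) (θ s y))) x
      (eulerFlux σ j (stateOf (ρ s x) (u s x) (θ s x)))) = fun x => ∑ j,
      Torus.partialDeriv j (fun y => ρ s y * u s y j * hsCompressibility (ρ s y * σ ^ 3)) x := by
    funext x
    exact Finset.sum_congr rfl fun j _ => partialDeriv_Lambda_flux hFa hF hσ hE hη hpack hs x j
  rw [hfun, integral_finsetSum _ fun j _ => ((hg j).partialDeriv j).integrable]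
  exact Finset.sum_eq_zero fun j _ =>
    Torus.integral_partialDeriv_eq_zero_of_isContDiff ((hg j).isContDiff (by simp)) j

/-- **Registered sub-goal `stub_thermo_compat` of `stub_thermo`**: clause 3 of `ThermoChamber η`
(with its two `let`s expanded) for every `η ≤ η₀` of an `HsEosLowDensity` witness `(η₀, F)`. -/
theorem stub_thermo_compat : ∀ (η₀ : ℝ) (F : ℝ → ℝ), AnalyticOnNhd ℝ F (Ioo (-η₀) η₀) →
    EqOn hsExcessFreeEnergy F (Ico 0 η₀) → ∀ σ η : ℝ, 0 < σ → η ≤ η₀ →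
    ∀ (T : ℝ) (ρ θ : ℝ → T3 → ℝ) (u : ℝ → T3 → V3), IsHardSphereEulerSolution σ T ρ u θ →
      (∀ s ∈ Ico 0 T, ∀ x, ρ s x * σ ^ 3 < η) →
      Torus.IsSmoothSpaceTimeOn (Ico 0 T)
          (fun s x => fderiv ℝ (hsEntropy σ) (stateOf (ρ s x) (u s x) (θ s x))) ∧
      (∀ s ∈ Ico 0 T, ∀ x, ∀ V : State,
        fderiv ℝ (hsEntropy σ) (stateOf (ρ s x) (u s x) (θ s x)) V =
          (Real.log (ρ s x) + hsExcessFreeEnergy (ρ s x * σ ^ 3) +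
              ρ s x * σ ^ 3 * deriv hsExcessFreeEnergy (ρ s x * σ ^ 3) -
              3 / 2 * Real.log (θ s x) - ‖u s x‖ ^ 2 / (2 * θ s x) + 5 / 2) * V.1 +
            inner ℝ ((θ s x)⁻¹ • u s x) V.2.1 - (θ s x)⁻¹ * V.2.2) ∧
      (∀ s ∈ Ico 0 T, ∀ x, ∀ V : State,
        Torus.timeDerivWithin (Ico 0 T)
            (fun s x => fderiv ℝ (hsEntropy σ) (stateOf (ρ s x) (u s x) (θ s x))) s x V +
          ∑ j, Torus.partialDeriv j
            (fun y => fderiv ℝ (hsEntropy σ) (stateOf (ρ s y) (u s y) (θ s y))) x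
            (fderiv ℝ (eulerFlux σ j) (stateOf (ρ s x) (u s x) (θ s x)) V) = 0) ∧
      (∀ s ∈ Ico 0 T, ∫ x, ∑ j, Torus.partialDeriv j
          (fun y => fderiv ℝ (hsEntropy σ) (stateOf (ρ s y) (u s y) (θ s y))) x
          (eulerFlux σ j (stateOf (ρ s x) (u s x) (θ s x))) = 0) := by
  intro η₀ F hFa hF σ η hσ hη T ρ θ u hE hpack
  refine ⟨isSmoothSpaceTimeOn_Lambda hFa hF hσ hE hη hpack, fun s hs x V => ?_,
    fun s hs x V => compat_identity hFa hF hσ hE hη hpack hs x V,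
    fun s hs => integral_Lambda_flux hFa hF hσ hE hη hpack hs⟩
  exact fderiv_hsEntropy_apply hFa hF (u s x) hσ (hE.density_pos s hs x) (hE.temperature_pos s hs x)
    (lt_of_lt_of_le (hpack s hs x) hη) V

end Barycentric

end Summit.AtomisticToContinuum.HydrodynamicLimit.Theorems.MacroClosureLine

end
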